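import Summits.QuantumFields.YangMills.Theorems.BalabanUVNodesN21FineTestTransfer
import Summits.QuantumFields.YangMills.Theorems.BalabanUVNodesN21ClosenessJunction

/-!
# YM-DAG node N21 (= NE7c) — THE N16 ⊗ N21 JUNCTION AT RUN B's OWN FINE TEST: under N16's statement of record
# (`NE3EnergyRateWCov`, BY NAME) and the sup-regularity SHAPE of run B's minimiser (`RegularSup`, BY NAME), run A's slot
# variable `‖U_A(∂p′) − 1‖` and run B's OWN tested variable `L²·‖U_B(∂p₀) − 1‖` (any fine plaquette `p₀` of the stencil of
# `p′`) differ by at most `C_Q·θ^{13k} + E_{k+1}`; the four mismatch pieces of the two runs' sharp indicators AT RUN B's OWN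
# TEST lie in single-run shells of that width; relatively `≤ ((C_Q + K)∕ε)·θ^k` — road I's rate binder again

Track A of `YM-PLAN.md` (cell `pub-ymgap`, HUMAN RULING D-0062), node **N21** of 28; seat `pub-ymgap-dag-n21-a`, generation 3,
file 6 (files 4∕4′∕5: `BalabanUVNodesN21AveragingLower` ∕ `…AveragingOscillation` ∕ `…FineTestTransfer`; file 3 =
`BalabanUVNodesN21ClosenessJunction`, p410611).  `--supports stmt-QuantumFields-19182`.  Kernel bookkeeping over LANDED theorems
BY NAME: 0 `def`, 0 `sorry`, standard axioms.  COUNT-NEUTRAL.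

HONEST FRAMING.  NE7c (`T4IndicatorShell.ShellWeightBound`) is NOT PRINTED and NOT PROVED here; N16 (`NE3EnergyRateWCov … dom`) is
NOT PRINTED and NOT PROVED — it is THE HYPOTHESIS `hcov` (exactly as in file 3); the sup-regularity of run B's minimiser
(`MinimalActionRefine.RegularSup 4 L N b cg (k+1) U_B` — [Balaban1985Variational] Thm 1 (8) + (10) read as pointwise bounds, a
SHAPE asserted for no configuration) is THE HYPOTHESIS `hsup` (N16 ∕ N07 species: the regularity of minimisers).  What this file
adds to file 3 is the CONVERSE half of the (F∞) transfer — dag-ref-B READ #53's «run B's own fine test»: file 3 compared run A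
with `W = rescale L (bavg L U_B)` (run B READ ON THE COMMON LATTICE); here run B is read by ITS OWN classifier on its FINE
plaquettes ([Balaban1988Convergent] (2.17) p. 257), through file 5's two-sided transfer `|‖W(∂p′) − 1‖ − L²‖U_B(∂p₀) − 1‖| ≤ E_{k+1}`.
Remaining NODE-O bookkeeping (not here): the slot's `sup` over the plaquettes of a cube and «every fine plaquette of a cube lies in
the stencil of a coarse plaquette of the cube» — finite geometry of the term object.  One finite four-torus programme at fixed
`ε`; NOT continuum ∕ ℝ⁴ ∕ OS ∕ mass gap ∕ Clay.

CITATION HEADER (lean-in-tree rule 2026-08-18).  Everything BY NAME from the tree: file 3's `dev_close_of_n16` (with its binder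
list = that of `NE3.CovariantRoot.closeness_of_ne3EnergyRateWCov`), `relWidth_le`, `theta_lt_one`; file 5's
`abs_fine_coarse_of_regularSup`, `relErrFine_le`; file 1's `n21_knit_levels`; `T4IndicatorShell` §3 (`smallInd_mul_one_sub_le`,
`largeInd_mul_one_sub_le`, `abs_sub_comm_le`).  Context only: [Balaban1985Averaging] (42)∕(44)∕Prop. 1; [Balaban1985Variational]
Thm 1 (8)–(10) p. 279; [Balaban1988Convergent] (2.17) p. 257.  No printed sentence is a hypothesis of any declaration.

WHAT IS PROVED ([folklore]).
* §1 `smallInd_scaled`, `largeInd_scaled`: run B's own test `u < t∕L²` IS the test `L²u < t` on the rescaled variable;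
  `exists_block_decomp`: every fine plaquette lies in the stencil of the coarse plaquette of its block.
* §2 `abs_devA_sub_scaledFine_le_of_n16`: `hcov` + `hsup` + file 3's side letters ⇒ for every coarse plaquette `p′ = (z; π)` of
  run A's lattice and every fine stencil plaquette `p₀ = (L·z + r₀ + i₀e_μ + j₀e_ν; π)` of run B's:
  `|‖U_A(∂p′) − 1‖ − L²‖U_B(∂p₀) − 1‖| ≤ C_Qθ^{13k} + E_{k+1}`; `exists_coarse_partner_of_n16`: hence EVERY fine plaquette of run B
  has a coarse partner of run A with that closeness.
* §3 `fineTest_shell_domination_of_n16`: the four mismatch pieces of `χ_t(u^A)`, `ζ_t(u^A)` against run B's OWN indicators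
  `χ_{t∕L²}(u^B(p₀))`, `ζ_{t∕L²}(u^B(p₀))` lie in single-run shells of width `C_Qθ^{13k} + E_{k+1}` (in `u^A`, resp. in `L²u^B`).
* §4 `relWidth_fineTest_of_n16`: against any threshold `t ≥ ε(L⁻¹)^{2k}`: `(C_Qθ^{13k} + E_{k+1})∕t ≤ ((C_Q + K)∕ε)·θ^k`
  (`(L⁻¹)^k = θ^{6k} ≤ θ^k`) — LITERALLY `ρ_k ≤ c₁ϑ^k`, `c₁ = (C_Q + K)∕ε`, `ϑ = θ`.
* §5 `n21_knit_levels_of_fineTestWidth`: file 1's road I with both width families set to THIS width (rate binders by `le_rfl`).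
-/

set_option autoImplicit false

noncomputable section

open scoped BigOperators Matrix Matrix.Norms.L2Operator

namespace Summit.QuantumFields.YangMills.Theorems.N21FineTestJunction

open Literature.MathematicalPhysics.QuantumFieldTheory.Balaban1983to89
open B7Prop1Explicit B7Prop2Explicit
open T4IndicatorShell (smallInd largeInd shellBelow shellAbove smallInd_mul_one_sub_le largeInd_mul_one_sub_le
  abs_sub_comm_le ShellWeightBound)
open T4AveragingDeficitWall (IsUnitaryCfg SmallField Plane)
open T4ShellMeasureLevels (LevelLedger LiveWindow)
open Summit.QuantumFields.BalabanUV.T4Continuum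
open MinimalActionSandwich (IsMinimiser)
open MinimalActionRate (Regular)
open MinimalActionRefine (RegularSup)
open NE3EnergyWeightedCovShape (NE3EnergyRateWCov)
open AveragingDeficitDualResidual (dualC1 dualC2)
open AveragingDeficitDerivWallProof (wallConst)
open N21ClosenessJunction (dev_close_of_n16 relWidth_le theta_lt_one)
open N21FineTestTransfer (abs_fine_coarse_of_regularSup relErrFine_le)

/-! ## §1 Run B's own threshold is the rescaled threshold -/

/-- `χ_{t∕c}(u) = χ_t(c·u)` for `c > 0`: run B's own small-field test at the fine threshold `t∕L²` IS the test of the rescaled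
variable `L²·u` at `t`. [folklore] -/
theorem smallInd_scaled {c u t : ℝ} (hc : 0 < c) : smallInd u (t / c) = smallInd (c * u) t := by
  unfold smallInd
  have e1 : (u < t / c) ↔ (c * u < t) := by rw [lt_div_iff₀ hc, mul_comm]
  simp only [e1]

/-- `ζ_{t∕c}(u) = ζ_t(c·u)` for `c > 0`. [folklore] -/
theorem largeInd_scaled {c u t : ℝ} (hc : 0 < c) : largeInd u (t / c) = largeInd (c * u) t := by
  unfold largeInd
  have e1 : (t / c ≤ u) ↔ (t ≤ c * u) := by rw [div_le_iff₀ hc, mul_comm]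
  simp only [e1]

/-- **EVERY FINE PLAQUETTE LIES IN A STENCIL**: division with remainder coordinate by coordinate, `w = L·⌊w∕L⌋ + (w mod L)`,
`w mod L ∈ [0,L)^d` — so the fine plaquette at `w` is the stencil plaquette `(r, i, j) = (w mod L, 0, 0)` of the coarse plaquette
with corner `L·⌊w∕L⌋` (the companion of `T4AveragingDeficitWallBoundary.blockMap_injective`). [folklore] -/
theorem exists_block_decomp {d L : ℕ} (hL : 1 ≤ L) (w : B7Prop1Explicit.Site d) :
    ∃ (x : B7Prop1Explicit.Site d) (r : Fin d → Fin L), w = (L : ℤ) • x + boxVec L r := by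
  have hL0 : (0 : ℤ) < (L : ℤ) := by exact_mod_cast (by omega : 0 < L)
  have hlt : ∀ κ, (w κ % (L : ℤ)).toNat < L := fun κ => by
    have h1 := Int.emod_nonneg (w κ) (ne_of_gt hL0)
    have h2 := Int.emod_lt_of_pos (w κ) hL0
    omega
  refine ⟨fun κ => w κ / (L : ℤ), fun κ => ⟨(w κ % (L : ℤ)).toNat, hlt κ⟩, ?_⟩
  funext κ
  simp only [Pi.add_apply, Pi.smul_apply, smul_eq_mul, boxVec]
  rw [Int.toNat_of_nonneg (Int.emod_nonneg _ (ne_of_gt hL0))]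
  exact (Int.mul_ediv_add_emod (w κ) (L : ℤ)).symm

/-! ## §2 The fine-test closeness display: N16 (file 3) + the transfer (file 5) -/

variable {n : Type*} [Fintype n] [DecidableEq n] [Nonempty n]
  {𝒞 : ℕ → Set (B7Prop1Explicit.Site 4 → Fin 4 → (Matrix n n ℂ)ˣ)} {L N : ℕ} {θ b g C Λ₁ Λ₂' γ l₁ cg : ℝ}
  {dom : Set (B7Prop1Explicit.Site 4 → Fin 4 → (Matrix n n ℂ)ˣ)} {k : ℕ}
  {V UA UB : B7Prop1Explicit.Site 4 → Fin 4 → (Matrix n n ℂ)ˣ}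

/-- **THE FINE-TEST CLOSENESS DISPLAY.**  HYPOTHESES: N16's statement of record `hcov : NE3EnergyRateWCov 4 𝒞 L N b g C Λ₁ Λ₂′ dom`
[NOT PRINTED, NOT PROVED] with the side letters of its consumer END (verbatim as in file 3's `dev_close_of_n16`), and the
sup-regularity SHAPE `hsup : RegularSup 4 L N b cg (k+1) U_B` of run B's minimiser [N16 ∕ N07 species].  CONCLUSION: for every coarse
plaquette `(z; π)` of run A's lattice and every fine plaquette `(L·z + r₀ + i₀e_μ + j₀e_ν; π)` of the averaging stencil
(`μ = π.1.1 < ν = π.1.2`), run A's slot variable and run B's OWN tested variable, rescaled, differ by at most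
`C_Qθ^{13k} + E_{k+1}` (`C_Q = 8l₁√(2γΛ₂′) + 1536l₁⁴γ²e^{8l₁²γ}`, `E_{k+1}` of file 5 §2 at `d = 4`). [folklore] -/
theorem abs_devA_sub_scaledFine_le_of_n16 (hL : 2 ≤ L) (hN : 1 ≤ N) (hθ : 0 < θ) (hθ6 : θ ^ 6 = ((L : ℝ))⁻¹) (hb : 0 ≤ b)
    (hbs : 512 * (4 + 1) * (4 + 4) * (L : ℝ) ^ 2 * b ≤ 1) (hg : 0 ≤ g) (hC : 0 ≤ C) (hΛ₂' : 0 < Λ₂')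
    (hcov : NE3EnergyRateWCov 4 𝒞 L N b g C Λ₁ Λ₂' dom)
    (hγ : 0 < γ) (hγ3 : C * (wallConst 4 L * (N : ℝ) ^ 2 * (Real.sqrt g * dualC2 4 L + 2 * b ^ 2 * dualC1 4 L)) ≤ γ ^ 3)
    (hl₁ : 0 < l₁) (hΛl₁ : Λ₁ ≤ l₁ ^ 3) (hk : 1 ≤ k) (hfit : γ * (θ ^ k) ^ 2 ≤ l₁ * N) (hV : V ∈ dom)
    (hA : IsMinimiser 4 𝒞 L N k V UA) (hB : IsMinimiser 4 𝒞 L N (k + 1) V UB) (hreg : Regular 4 L N b g (k + 1) UB)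
    (hsup : RegularSup 4 L N b cg (k + 1) UB)
    (z : B7Prop1Explicit.Site 4) (π : Plane 4) (r₀ : Fin 4 → Fin L) {i₀ j₀ : ℕ} (hi₀ : i₀ < L) (hj₀ : j₀ < L) :
    |‖((hol UA z (plaqWord π.1.1 π.1.2) : (Matrix n n ℂ)ˣ) : Matrix n n ℂ) - 1‖
        - (L : ℝ) ^ 2 * ‖((hol UB ((L : ℤ) • z + boxVec L r₀ + (i₀ : ℤ) • e π.1.1 + (j₀ : ℤ) • e π.1.2)
            (plaqWord π.1.1 π.1.2) : (Matrix n n ℂ)ˣ) : Matrix n n ℂ) - 1‖|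
      ≤ (8 * l₁ * Real.sqrt (2 * γ * Λ₂') + 1536 * l₁ ^ 4 * γ ^ 2 * Real.exp (8 * l₁ ^ 2 * γ)) * θ ^ (13 * k)
        + ((L : ℝ) ^ 2 * (((2 * (4 * L) + 4 * L : ℕ) : ℝ)
          * (cg / ((L : ℝ) ^ (k + 1)) ^ 3 * Real.exp (2 * (b / ((L : ℝ) ^ (k + 1)) ^ 2))
            + 2 * (((3 * (4 * L) + 8 * L : ℕ) : ℝ) * (b / ((L : ℝ) ^ (k + 1)) ^ 2)) * (b / ((L : ℝ) ^ (k + 1)) ^ 2)))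
        + 226 * (8 * ((4 : ℕ) + 1 : ℝ) * ((4 : ℕ) + 4 : ℝ) * (L : ℝ) ^ 2 * (b / ((L : ℝ) ^ (k + 1)) ^ 2)) ^ 2) := by
  have h16 := dev_close_of_n16 hL hN hθ hθ6 hb hbs hg hC hΛ₂' hcov hγ hγ3 hl₁ hΛl₁ hk hfit hV hA hB hreg z π.1.1 π.1.2
  have hbs' : 512 * ((4 : ℕ) + 1 : ℝ) * ((4 : ℕ) + 4 : ℝ) * (L : ℝ) ^ 2 * b ≤ 1 := by push_cast at hbs ⊢; exact hbs
  have h5 : |‖((hol (rescale L (bavg L UB)) z (plaqWord π.1.1 π.1.2) : (Matrix n n ℂ)ˣ) : Matrix n n ℂ) - 1‖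
        - (L : ℝ) ^ 2 * ‖((hol UB ((L : ℤ) • z + boxVec L r₀ + (i₀ : ℤ) • e π.1.1 + (j₀ : ℤ) • e π.1.2)
            (plaqWord π.1.1 π.1.2) : (Matrix n n ℂ)ˣ) : Matrix n n ℂ) - 1‖|
      ≤ ((L : ℝ) ^ 2 * (((2 * (4 * L) + 4 * L : ℕ) : ℝ)
          * (cg / ((L : ℝ) ^ (k + 1)) ^ 3 * Real.exp (2 * (b / ((L : ℝ) ^ (k + 1)) ^ 2))
            + 2 * (((3 * (4 * L) + 8 * L : ℕ) : ℝ) * (b / ((L : ℝ) ^ (k + 1)) ^ 2)) * (b / ((L : ℝ) ^ (k + 1)) ^ 2)))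
        + 226 * (8 * ((4 : ℕ) + 1 : ℝ) * ((4 : ℕ) + 4 : ℝ) * (L : ℝ) ^ 2 * (b / ((L : ℝ) ^ (k + 1)) ^ 2)) ^ 2) :=
    abs_fine_coarse_of_regularSup (d := 4) (by omega : 1 ≤ L) hb hbs' hsup z π r₀ hi₀ hj₀
  have t1 := abs_sub_le_iff.1 h16
  have t2 := abs_sub_le_iff.1 h5
  rw [abs_sub_le_iff]
  constructor <;> linarith [t1.1, t1.2, t2.1, t2.2]

/-- **… FOR EVERY FINE PLAQUETTE**: under the same hypotheses, EVERY fine plaquette `(w; π)` of run B's lattice has a coarse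
partner `(x; π)` of run A's lattice — the plaquette whose averaging block contains it, `w = L·x + r` — with
`|‖U_A(∂p_x) − 1‖ − L²‖U_B(∂p_w) − 1‖| ≤ C_Qθ^{13k} + E_{k+1}` (§1 `exists_block_decomp` with `i₀ = j₀ = 0`).  The cube-`sup`
bookkeeping of the (2.17) slots (NODE O) then inherits the width: a finite `sup` of pairwise-close families. [folklore] -/
theorem exists_coarse_partner_of_n16 (hL : 2 ≤ L) (hN : 1 ≤ N) (hθ : 0 < θ) (hθ6 : θ ^ 6 = ((L : ℝ))⁻¹) (hb : 0 ≤ b)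
    (hbs : 512 * (4 + 1) * (4 + 4) * (L : ℝ) ^ 2 * b ≤ 1) (hg : 0 ≤ g) (hC : 0 ≤ C) (hΛ₂' : 0 < Λ₂')
    (hcov : NE3EnergyRateWCov 4 𝒞 L N b g C Λ₁ Λ₂' dom)
    (hγ : 0 < γ) (hγ3 : C * (wallConst 4 L * (N : ℝ) ^ 2 * (Real.sqrt g * dualC2 4 L + 2 * b ^ 2 * dualC1 4 L)) ≤ γ ^ 3)
    (hl₁ : 0 < l₁) (hΛl₁ : Λ₁ ≤ l₁ ^ 3) (hk : 1 ≤ k) (hfit : γ * (θ ^ k) ^ 2 ≤ l₁ * N) (hV : V ∈ dom)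
    (hA : IsMinimiser 4 𝒞 L N k V UA) (hB : IsMinimiser 4 𝒞 L N (k + 1) V UB) (hreg : Regular 4 L N b g (k + 1) UB)
    (hsup : RegularSup 4 L N b cg (k + 1) UB) (w : B7Prop1Explicit.Site 4) (π : Plane 4) :
    ∃ (x : B7Prop1Explicit.Site 4) (r : Fin 4 → Fin L), w = (L : ℤ) • x + boxVec L r ∧
      |‖((hol UA x (plaqWord π.1.1 π.1.2) : (Matrix n n ℂ)ˣ) : Matrix n n ℂ) - 1‖
          - (L : ℝ) ^ 2 * ‖((hol UB w (plaqWord π.1.1 π.1.2) : (Matrix n n ℂ)ˣ) : Matrix n n ℂ) - 1‖|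
        ≤ (8 * l₁ * Real.sqrt (2 * γ * Λ₂') + 1536 * l₁ ^ 4 * γ ^ 2 * Real.exp (8 * l₁ ^ 2 * γ)) * θ ^ (13 * k)
          + ((L : ℝ) ^ 2 * (((2 * (4 * L) + 4 * L : ℕ) : ℝ)
          * (cg / ((L : ℝ) ^ (k + 1)) ^ 3 * Real.exp (2 * (b / ((L : ℝ) ^ (k + 1)) ^ 2))
            + 2 * (((3 * (4 * L) + 8 * L : ℕ) : ℝ) * (b / ((L : ℝ) ^ (k + 1)) ^ 2)) * (b / ((L : ℝ) ^ (k + 1)) ^ 2)))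
        + 226 * (8 * ((4 : ℕ) + 1 : ℝ) * ((4 : ℕ) + 4 : ℝ) * (L : ℝ) ^ 2 * (b / ((L : ℝ) ^ (k + 1)) ^ 2)) ^ 2) := by
  have hL0 : 0 < L := by omega
  obtain ⟨x, r, hw⟩ := exists_block_decomp (by omega : 1 ≤ L) w
  refine ⟨x, r, hw, ?_⟩
  have h := abs_devA_sub_scaledFine_le_of_n16 hL hN hθ hθ6 hb hbs hg hC hΛ₂' hcov hγ hγ3 hl₁ hΛl₁ hk hfit hV hA hB hreg
    hsup x π r (i₀ := 0) (j₀ := 0) hL0 hL0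
  simp only [Nat.cast_zero, zero_smul, add_zero] at h
  rw [hw]
  exact h

/-! ## §3 Shell domination AT RUN B's OWN TEST -/

/-- **SHELL DOMINATION AT RUN B's OWN FINE TEST.**  Under the hypotheses of `abs_devA_sub_scaledFine_le_of_n16`, at every coarse
plaquette `p′` of run A, every fine stencil plaquette `p₀` of run B and EVERY threshold `t`, with `u^A = ‖U_A(∂p′) − 1‖`,
`u^B = ‖U_B(∂p₀) − 1‖` and any width `δ ≥ C_Qθ^{13k} + E_{k+1}`: the mismatch «A small at `t`, B NOT small at its own threshold `t∕L²`» lies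
in run A's shell BELOW `t` of width `δ`; «B small at `t∕L²`, A not small at `t`» in the shell below `t` of `L²u^B`; and the two
large-field polarities in the shells ABOVE (`T4IndicatorShell` §3 BY NAME + §1). [folklore] -/
theorem fineTest_shell_domination_of_n16 (hL : 2 ≤ L) (hN : 1 ≤ N) (hθ : 0 < θ) (hθ6 : θ ^ 6 = ((L : ℝ))⁻¹) (hb : 0 ≤ b)
    (hbs : 512 * (4 + 1) * (4 + 4) * (L : ℝ) ^ 2 * b ≤ 1) (hg : 0 ≤ g) (hC : 0 ≤ C) (hΛ₂' : 0 < Λ₂')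
    (hcov : NE3EnergyRateWCov 4 𝒞 L N b g C Λ₁ Λ₂' dom)
    (hγ : 0 < γ) (hγ3 : C * (wallConst 4 L * (N : ℝ) ^ 2 * (Real.sqrt g * dualC2 4 L + 2 * b ^ 2 * dualC1 4 L)) ≤ γ ^ 3)
    (hl₁ : 0 < l₁) (hΛl₁ : Λ₁ ≤ l₁ ^ 3) (hk : 1 ≤ k) (hfit : γ * (θ ^ k) ^ 2 ≤ l₁ * N) (hV : V ∈ dom)
    (hA : IsMinimiser 4 𝒞 L N k V UA) (hB : IsMinimiser 4 𝒞 L N (k + 1) V UB) (hreg : Regular 4 L N b g (k + 1) UB)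
    (hsup : RegularSup 4 L N b cg (k + 1) UB)
    (z : B7Prop1Explicit.Site 4) (π : Plane 4) (r₀ : Fin 4 → Fin L) {i₀ j₀ : ℕ} (hi₀ : i₀ < L) (hj₀ : j₀ < L) (t : ℝ) :
    ∀ δ : ℝ, (8 * l₁ * Real.sqrt (2 * γ * Λ₂') + 1536 * l₁ ^ 4 * γ ^ 2 * Real.exp (8 * l₁ ^ 2 * γ)) * θ ^ (13 * k)
        + ((L : ℝ) ^ 2 * (((2 * (4 * L) + 4 * L : ℕ) : ℝ)
          * (cg / ((L : ℝ) ^ (k + 1)) ^ 3 * Real.exp (2 * (b / ((L : ℝ) ^ (k + 1)) ^ 2))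
            + 2 * (((3 * (4 * L) + 8 * L : ℕ) : ℝ) * (b / ((L : ℝ) ^ (k + 1)) ^ 2)) * (b / ((L : ℝ) ^ (k + 1)) ^ 2)))
        + 226 * (8 * ((4 : ℕ) + 1 : ℝ) * ((4 : ℕ) + 4 : ℝ) * (L : ℝ) ^ 2 * (b / ((L : ℝ) ^ (k + 1)) ^ 2)) ^ 2) ≤ δ →
    smallInd ‖((hol UA z (plaqWord π.1.1 π.1.2) : (Matrix n n ℂ)ˣ) : Matrix n n ℂ) - 1‖ t
        * (1 - smallInd ‖((hol UB ((L : ℤ) • z + boxVec L r₀ + (i₀ : ℤ) • e π.1.1 + (j₀ : ℤ) • e π.1.2)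
            (plaqWord π.1.1 π.1.2) : (Matrix n n ℂ)ˣ) : Matrix n n ℂ) - 1‖ (t / (L : ℝ) ^ 2))
        ≤ shellBelow ‖((hol UA z (plaqWord π.1.1 π.1.2) : (Matrix n n ℂ)ˣ) : Matrix n n ℂ) - 1‖ t δ ∧
      smallInd ‖((hol UB ((L : ℤ) • z + boxVec L r₀ + (i₀ : ℤ) • e π.1.1 + (j₀ : ℤ) • e π.1.2)
            (plaqWord π.1.1 π.1.2) : (Matrix n n ℂ)ˣ) : Matrix n n ℂ) - 1‖ (t / (L : ℝ) ^ 2)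
        * (1 - smallInd ‖((hol UA z (plaqWord π.1.1 π.1.2) : (Matrix n n ℂ)ˣ) : Matrix n n ℂ) - 1‖ t)
        ≤ shellBelow ((L : ℝ) ^ 2 * ‖((hol UB ((L : ℤ) • z + boxVec L r₀ + (i₀ : ℤ) • e π.1.1 + (j₀ : ℤ) • e π.1.2)
            (plaqWord π.1.1 π.1.2) : (Matrix n n ℂ)ˣ) : Matrix n n ℂ) - 1‖) t δ ∧
      largeInd ‖((hol UA z (plaqWord π.1.1 π.1.2) : (Matrix n n ℂ)ˣ) : Matrix n n ℂ) - 1‖ t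
        * (1 - largeInd ‖((hol UB ((L : ℤ) • z + boxVec L r₀ + (i₀ : ℤ) • e π.1.1 + (j₀ : ℤ) • e π.1.2)
            (plaqWord π.1.1 π.1.2) : (Matrix n n ℂ)ˣ) : Matrix n n ℂ) - 1‖ (t / (L : ℝ) ^ 2))
        ≤ shellAbove ‖((hol UA z (plaqWord π.1.1 π.1.2) : (Matrix n n ℂ)ˣ) : Matrix n n ℂ) - 1‖ t δ ∧
      largeInd ‖((hol UB ((L : ℤ) • z + boxVec L r₀ + (i₀ : ℤ) • e π.1.1 + (j₀ : ℤ) • e π.1.2)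
            (plaqWord π.1.1 π.1.2) : (Matrix n n ℂ)ˣ) : Matrix n n ℂ) - 1‖ (t / (L : ℝ) ^ 2)
        * (1 - largeInd ‖((hol UA z (plaqWord π.1.1 π.1.2) : (Matrix n n ℂ)ˣ) : Matrix n n ℂ) - 1‖ t)
        ≤ shellAbove ((L : ℝ) ^ 2 * ‖((hol UB ((L : ℤ) • z + boxVec L r₀ + (i₀ : ℤ) • e π.1.1 + (j₀ : ℤ) • e π.1.2)
            (plaqWord π.1.1 π.1.2) : (Matrix n n ℂ)ˣ) : Matrix n n ℂ) - 1‖) t δ := by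
  intro δ hδ
  have hL2 : (0 : ℝ) < (L : ℝ) ^ 2 := by
    have : (0 : ℝ) < L := by exact_mod_cast (by omega : 0 < L)
    positivity
  have h := (abs_devA_sub_scaledFine_le_of_n16 hL hN hθ hθ6 hb hbs hg hC hΛ₂' hcov hγ hγ3 hl₁ hΛl₁ hk hfit hV hA hB hreg
    hsup z π r₀ hi₀ hj₀).trans hδ
  rw [smallInd_scaled hL2, largeInd_scaled hL2]
  exact ⟨smallInd_mul_one_sub_le h, smallInd_mul_one_sub_le (abs_sub_comm_le h), largeInd_mul_one_sub_le h,
    largeInd_mul_one_sub_le (abs_sub_comm_le h)⟩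

/-! ## §4 The relative width at run B's own test: `ρ_k ≤ c₁ϑ^k` with `c₁ = (C_Q + K)∕ε`, `ϑ = θ` -/

omit [Fintype n] [DecidableEq n] [Nonempty n] in
/-- `(L⁻¹)^k = θ^{6k} ≤ θ^k` for `θ⁶ = L⁻¹`, `0 ≤ θ ≤ 1`. [folklore] -/
theorem inv_pow_le_theta_pow (hL : 2 ≤ L) (hθ : 0 < θ) (hθ6 : θ ^ 6 = ((L : ℝ))⁻¹) (k : ℕ) :
    ((L : ℝ)⁻¹) ^ k ≤ θ ^ k := by
  rw [← hθ6, ← pow_mul]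
  exact pow_le_pow_of_le_one hθ.le (theta_lt_one hL hθ6).le (by omega)

/-- **THE (F∞) RATE BINDER AT RUN B's OWN TEST.**  Under the hypotheses of `abs_devA_sub_scaledFine_le_of_n16` with `0 ≤ cg` and for
any threshold `t ≥ ε·(L⁻¹)^{2k}` (`ε > 0`): the RELATIVE width is at most `((C_Q + K)∕ε)·θ^k`,
`K = 4(2·4+4)cg + (4(4+2)(3·4+8) + 14464(4+1)²(4+4)²)b²` (file 3's `relWidth_le` for `C_Qθ^{13k}`, file 5's `relErrFine_le` for
`E_{k+1}`, and `(L⁻¹)^k ≤ θ^k`).  CONDITIONAL on `hcov` (N16) and `hsup`. [folklore] -/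
theorem relWidth_fineTest_of_n16 (hL : 2 ≤ L) (hN : 1 ≤ N) (hθ : 0 < θ) (hθ6 : θ ^ 6 = ((L : ℝ))⁻¹) (hb : 0 ≤ b)
    (hbs : 512 * (4 + 1) * (4 + 4) * (L : ℝ) ^ 2 * b ≤ 1) (hg : 0 ≤ g) (hC : 0 ≤ C) (hΛ₂' : 0 < Λ₂')
    (hcov : NE3EnergyRateWCov 4 𝒞 L N b g C Λ₁ Λ₂' dom)
    (hγ : 0 < γ) (hγ3 : C * (wallConst 4 L * (N : ℝ) ^ 2 * (Real.sqrt g * dualC2 4 L + 2 * b ^ 2 * dualC1 4 L)) ≤ γ ^ 3)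
    (hl₁ : 0 < l₁) (hΛl₁ : Λ₁ ≤ l₁ ^ 3) (hk : 1 ≤ k) (hfit : γ * (θ ^ k) ^ 2 ≤ l₁ * N) (hV : V ∈ dom)
    (hA : IsMinimiser 4 𝒞 L N k V UA) (hB : IsMinimiser 4 𝒞 L N (k + 1) V UB) (hreg : Regular 4 L N b g (k + 1) UB)
    (hcg : 0 ≤ cg) (hsup : RegularSup 4 L N b cg (k + 1) UB)
    {ε t : ℝ} (hε : 0 < ε) (ht : ε * ((L : ℝ)⁻¹) ^ (2 * k) ≤ t)
    (z : B7Prop1Explicit.Site 4) (π : Plane 4) (r₀ : Fin 4 → Fin L) {i₀ j₀ : ℕ} (hi₀ : i₀ < L) (hj₀ : j₀ < L) :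
    |‖((hol UA z (plaqWord π.1.1 π.1.2) : (Matrix n n ℂ)ˣ) : Matrix n n ℂ) - 1‖
        - (L : ℝ) ^ 2 * ‖((hol UB ((L : ℤ) • z + boxVec L r₀ + (i₀ : ℤ) • e π.1.1 + (j₀ : ℤ) • e π.1.2)
            (plaqWord π.1.1 π.1.2) : (Matrix n n ℂ)ˣ) : Matrix n n ℂ) - 1‖| / t
      ≤ ((8 * l₁ * Real.sqrt (2 * γ * Λ₂') + 1536 * l₁ ^ 4 * γ ^ 2 * Real.exp (8 * l₁ ^ 2 * γ))
          + (4 * (2 * 4 + 4) * cg + (4 * (4 + 2) * (3 * 4 + 8) + 14464 * (4 + 1) ^ 2 * (4 + 4) ^ 2) * b ^ 2)) / ε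
        * θ ^ k := by
  have hL1 : 1 ≤ L := by omega
  have hL0 : (0 : ℝ) < (L : ℝ) := by exact_mod_cast (by omega : 0 < L)
  have ht0 : 0 < t := lt_of_lt_of_le (mul_pos hε (pow_pos (inv_pos.mpr hL0) _)) ht
  have hCQ : 0 ≤ 8 * l₁ * Real.sqrt (2 * γ * Λ₂') + 1536 * l₁ ^ 4 * γ ^ 2 * Real.exp (8 * l₁ ^ 2 * γ) := by positivity
  have hK : 0 ≤ 4 * (2 * 4 + 4) * cg + (4 * (4 + 2) * (3 * 4 + 8) + 14464 * (4 + 1) ^ 2 * (4 + 4) ^ 2) * b ^ 2 := by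
    positivity
  have h := abs_devA_sub_scaledFine_le_of_n16 hL hN hθ hθ6 hb hbs hg hC hΛ₂' hcov hγ hγ3 hl₁ hΛl₁ hk hfit hV hA hB hreg
    hsup z π r₀ hi₀ hj₀
  have hbs' : 512 * ((4 : ℕ) + 1 : ℝ) * ((4 : ℕ) + 4 : ℝ) * (L : ℝ) ^ 2 * b ≤ 1 := by push_cast at hbs ⊢; exact hbs
  -- the two relative pieces
  have r1 := relWidth_le hL1 hθ6 hCQ hε hθ.le k ht
  have r2 : ((L : ℝ) ^ 2 * (((2 * (4 * L) + 4 * L : ℕ) : ℝ)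
          * (cg / ((L : ℝ) ^ (k + 1)) ^ 3 * Real.exp (2 * (b / ((L : ℝ) ^ (k + 1)) ^ 2))
            + 2 * (((3 * (4 * L) + 8 * L : ℕ) : ℝ) * (b / ((L : ℝ) ^ (k + 1)) ^ 2)) * (b / ((L : ℝ) ^ (k + 1)) ^ 2)))
        + 226 * (8 * ((4 : ℕ) + 1 : ℝ) * ((4 : ℕ) + 4 : ℝ) * (L : ℝ) ^ 2 * (b / ((L : ℝ) ^ (k + 1)) ^ 2)) ^ 2) / t
      ≤ (4 * (2 * ((4 : ℕ) : ℝ) + 4) * cg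
        + (4 * (((4 : ℕ) : ℝ) + 2) * (3 * ((4 : ℕ) : ℝ) + 8) + 14464 * (((4 : ℕ) : ℝ) + 1) ^ 2 * (((4 : ℕ) : ℝ) + 4) ^ 2)
          * b ^ 2) / ε * ((L : ℝ)⁻¹) ^ k :=
    relErrFine_le (d := 4) hL1 hb hcg hbs' k hε ht
  have r3 : (4 * (2 * ((4 : ℕ) : ℝ) + 4) * cg
        + (4 * (((4 : ℕ) : ℝ) + 2) * (3 * ((4 : ℕ) : ℝ) + 8) + 14464 * (((4 : ℕ) : ℝ) + 1) ^ 2 * (((4 : ℕ) : ℝ) + 4) ^ 2)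
          * b ^ 2) / ε * ((L : ℝ)⁻¹) ^ k
      ≤ (4 * (2 * 4 + 4) * cg + (4 * (4 + 2) * (3 * 4 + 8) + 14464 * (4 + 1) ^ 2 * (4 + 4) ^ 2) * b ^ 2) / ε * θ ^ k := by
    push_cast
    exact mul_le_mul_of_nonneg_left (inv_pow_le_theta_pow hL hθ hθ6 k) (div_nonneg hK hε.le)
  rw [div_le_iff₀ ht0] at r1 r2 ⊢
  have r2' := r2.trans (mul_le_mul_of_nonneg_right r3 ht0.le)
  have e : ((8 * l₁ * Real.sqrt (2 * γ * Λ₂') + 1536 * l₁ ^ 4 * γ ^ 2 * Real.exp (8 * l₁ ^ 2 * γ))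
          + (4 * (2 * 4 + 4) * cg + (4 * (4 + 2) * (3 * 4 + 8) + 14464 * (4 + 1) ^ 2 * (4 + 4) ^ 2) * b ^ 2)) / ε
        * θ ^ k * t
      = (8 * l₁ * Real.sqrt (2 * γ * Λ₂') + 1536 * l₁ ^ 4 * γ ^ 2 * Real.exp (8 * l₁ ^ 2 * γ)) / ε * θ ^ k * t
        + (4 * (2 * 4 + 4) * cg + (4 * (4 + 2) * (3 * 4 + 8) + 14464 * (4 + 1) ^ 2 * (4 + 4) ^ 2) * b ^ 2) / ε
          * θ ^ k * t := by ring
  rw [e]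
  push_cast at h r2' ⊢
  linarith

/-! ## §5 Into file 1 BY NAME: road I at the fine-test width -/

section IntoKnit

variable {ι σA σB : Type*} {l₀ : ℝ} {T : ℕ → Finset ι} {A B shA shB : ℕ → ℝ → ι → ℝ}
  {SA : ℕ → Finset σA} {SB : ℕ → Finset σB} {pieceA : ℕ → ℝ → σA → ι → ℝ} {pieceB : ℕ → ℝ → σB → ι → ℝ}
  {lvlA : ℕ → σA → ℕ} {lvlB : ℕ → σB → ℕ} {DA DB : ℕ → ℝ} {N₁ : ℕ} {νbar Dbar : ℝ}

omit [Fintype n] [DecidableEq n] [Nonempty n] in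
/-- **ROAD I AT THE FINE-TEST WIDTH.**  File 1's knit `n21_knit_levels` with BOTH runs' level-width families SET TO the width of §4
in threshold units, `j ↦ ((C_Q + K)∕ε)·θ^j` (`C_Q`, `K` any reals here), `θ⁶ = L⁻¹`, `L ≥ 2`: the rate binders `hrateA`, `hrateB`
DISCHARGE by `le_rfl`, `0 < ϑ = θ < 1` by `theta_lt_one`; displayed remain [dict] + (M1) (the two `LevelLedger`s AT THESE WIDTHS),
N20's windows, `D ≤ D̄`.  NE7c NOT proved. [folklore] -/
theorem n21_knit_levels_of_fineTestWidth {L : ℕ} (hL : 2 ≤ L) {θ : ℝ} (hθ : 0 < θ) (hθ6 : θ ^ 6 = ((L : ℝ))⁻¹)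
    (CQ K ε : ℝ)
    (hAL : LevelLedger l₀ T A shA SA pieceA lvlA DA (fun j => (CQ + K) / ε * θ ^ j))
    (hBL : LevelLedger l₀ T B shB SB pieceB lvlB DB (fun j => (CQ + K) / ε * θ ^ j))
    (hwA : LiveWindow SA lvlA N₁ νbar) (hwB : LiveWindow SB lvlB N₁ νbar)
    (hDA : ∀ j, DA j ≤ Dbar) (hDB : ∀ j, DB j ≤ Dbar)
    {Wsh : ℕ → ℝ} (hWsh : ∀ K', (2 * ((N₁ + 1) * νbar * Dbar * ((CQ + K) / ε) * θ⁻¹ ^ N₁)) * θ ^ K' ≤ Wsh K')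
    (hsum : Summable Wsh) : ShellWeightBound l₀ T A B shA shB Wsh :=
  n21_knit_levels hAL hBL hwA hwB hDA hDB hθ (theta_lt_one hL hθ6) (fun _ => le_rfl) (fun _ => le_rfl) hWsh hsum

end IntoKnit

end Summit.QuantumFields.YangMills.Theorems.N21FineTestJunction

end
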